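import Literature.MathematicalPhysics.QuantumLattice.GaussianAdiabaticDressing
import Literature.MathematicalPhysics.QuantumLattice.SpinChargeKinematics
import Literature.MathematicalPhysics.QuantumLattice.CoordinateSlabs
import Literature.MathematicalPhysics.QuantumLattice.ClusteringFromCommutatorBounds
import Literature.MathematicalPhysics.QuantumLattice.LiebRobinsonBoundProofs
import Literature.MathematicalPhysics.QuantumLattice.LatticeToriProofs
import HarnessLib

/-!
# Locality in one coordinate direction for spin systems: Lieb–Robinson bound, clustering,
# boundary currents and the Gaussian quasi-adiabatic operators `K`, `K̃`

Generic analytic layer (arbitrary finite site set `Λ`, coordinate function `coord : Λ → ℤ/L`, a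
local interaction `Φ` of **coordinate range `r₀`** — every term lives in `r₀ + 1` consecutive
coordinate planes — with local strength `Σ_{Z ∋ x} ‖Φ Z‖ ≤ J` and term size `#Z ≤ V`) for the
Lieb–Schultz–Mattis case of Bachmann–Bols–De Roeck–Fraas, Comm. Math. Phys. **375** (2019) 1249
(BBDF), Proposition 2.4 and Assumptions (iv), (v), transposed from the tree's fermionic
`ChargeTransportLocality` to quantum SPIN systems, and with the **Gaussian** dressing
`gqaGenerator` (Hastings 2004) in place of the exact quasi-adiabatic generator. Everything is
PROVED (definitions with bodies + theorems, no named facts) and lives in the sub-namespace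
`SpinLSM` (the fermionic analogues `coord_lr`, `windowCurrent`, … of `ChargeTransportLocality`
occupy the same names one level up):

* `circDist_triangle`, `clevel_le_clevel_add_circDist` — the periodic distance is a metric and the
  `x₁`-level function of `CoordinateSlabs` is `1`-Lipschitz for it;
* `IsCoordLocal coord Φ r₀ V J` — the hypotheses on the interaction (local, coordinate range `r₀`,
  strength `J`, term size `V`);
* `coord_lr` — the Lieb–Robinson bound in the coordinate direction for `H = Σ_Z Φ Z`
  (`localHamiltonian Φ univ`): `‖[τ_t(A), B]‖ ≤ 2‖A‖‖B‖ #X e^{-(D - r₀)/(r₀+1) + 2eV(J+1)|t|}` for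
  `A ∈ 𝔄_X`, `B ∈ 𝔄_Y` at `x₁`-distance `≥ D` (the abstract graded bound
  `norm_comm_heisenbergEvolution_le_exp` with the grading `⌊min_Z level / (r₀+1)⌋`);
* `coord_clustering` — exponential clustering of the unique gapped ground state in the coordinate
  direction (BBDF Assumption (v) via Prop. 2.4, "proved in [Hastings 2004], see also
  [Nachtergaele–Sims 2007]"), from `coord_lr` and the generic Hastings–Koma assembly
  `clustering_of_commutator_bounds`.

* `crossingTerms`, `windowCurrent Φ S P` — the part `J(S,P)` of `[Q_S, H]` carried by the terms
  inside the window `P` (in `𝔄_P`, anti-Hermitian, `‖J‖ ≤ 2V #P J`), and the decomposition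
  `regionCharge_commutator_eq_add_windowCurrent` (`[Q_S,H] = J₁ + J₂` for a `U(1)`-invariant `Φ`);
* `kTildeG = i𝓖_a^H(J)` and the strictly local `kLocG = i𝓖_a^{H_B}(J)` (Hermitian; `kLocG_mem`:
  `K ∈ 𝔄_B`), **the ground state is an APPROXIMATE eigenvector of `Q_S - K̃₁ - K̃₂`** with error
  `e^{-γ²/(4a)} #S` (`eucNorm_regionCharge_sub_kTildeG_mulVec_le`, from
  `gqaGenerator_approx_intertwines'`), and the Gaussian locality `norm_kLocG_sub_kTildeG_le`:
  `‖K - K̃‖ ≤ ηT√(π/a)/2 + 2‖J‖e^{-aT²}/(2aT)`, `η = |Λ|J · 2V‖J‖ e^{-(R-r₀)/(r₀+1) + vT/(r₀+1)}`.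

## References

* S. Bachmann, A. Bols, W. De Roeck, M. Fraas, Comm. Math. Phys. **375** (2019) 1249, Prop. 2.4
  (proof), Assumptions (iv)–(v). [BachmannEtAl2019]
* M. B. Hastings, Phys. Rev. B **69** (2004) 104431, §II–III. [HastingsPRB2004]
* B. Nachtergaele, R. Sims, Comm. Math. Phys. **276** (2007) 437, §5 (Lieb–Robinson bounds and
  clustering in the `1`-direction). [NachtergaeleSimsCMP2007]
* M. B. Hastings, T. Koma, CMP **265** (2006) 781, Thm. 8. [HastingsKomaCMP2006]
* The tree: `LiebRobinsonBoundProofs` (`norm_comm_heisenbergEvolution_le_exp`),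
  `ClusteringFromCommutatorBounds` (`clustering_of_commutator_bounds`),
  `LiebRobinsonHastingsKomaSpectralProofs` (`norm_commutator_localHamiltonian_le`,
  `sum_filter_not_disjoint_le_sum_sum`), `CoordinateSlabs` (`clevel`, `cslab`, `zrange`),
  `HubbardTorusCharges` (`circDist`), `LatticeToriProofs` (`cyclicAbs_add_le`),
  `GaussianAdiabaticDressing`, `SpinChargeKinematics`.
-/

noncomputable section

namespace Literature.MathematicalPhysics.QuantumLattice

open Matrix Complex Finset
open scoped Matrix.Norms.L2Operator ComplexOrder

/-! ### The periodic distance is a metric; the level function is `1`-Lipschitz -/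

section Metric

variable {L : ℕ} [NeZero L]

/-- `circDist a b = |a - b|_L` with the cyclic absolute value `|z|_L = min(z.val, L - z.val)`. [folklore] -/
theorem circDist_eq_cyclicAbs (a b : ZMod L) : circDist a b = min (a - b).val (L - (a - b).val) := by
  unfold circDist
  by_cases h : a - b = 0
  · have hba : b - a = 0 := by rw [← neg_sub, h, neg_zero]
    rw [h, hba, ZMod.val_zero]
    simp
  · haveI : NeZero (a - b) := ⟨h⟩
    rw [show b - a = -(a - b) by ring, ZMod.val_neg_of_ne_zero]

/-- **Triangle inequality** for the periodic distance on `ℤ/L`. [folklore] -/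
theorem circDist_triangle (a b c : ZMod L) : circDist a c ≤ circDist a b + circDist b c := by
  rw [circDist_eq_cyclicAbs, circDist_eq_cyclicAbs, circDist_eq_cyclicAbs,
    show a - c = (a - b) + (b - c) by ring]
  exact cyclicAbs_add_le L (a - b) (b - c)

variable {Λ : Type*} [Fintype Λ] (coord : Λ → ZMod L)

omit [Fintype Λ] in
/-- **The level function is `1`-Lipschitz for the periodic distance of the coordinates**:
`δ_Y(z) ≤ δ_Y(z') + circDist(coord z, coord z')`. [folklore] -/
theorem clevel_le_clevel_add_circDist {Y : Finset Λ} (hY : Y.Nonempty) (z z' : Λ) :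
    clevel coord Y hY z ≤ clevel coord Y hY z' + circDist (coord z) (coord z') := by
  unfold clevel
  obtain ⟨b, hb, hmin⟩ := Finset.exists_mem_eq_inf' (hY.image coord) (fun b => circDist (coord z') b)
  rw [hmin]
  refine (Finset.inf'_le _ hb).trans ?_
  have := circDist_triangle (coord z) (coord z') b
  omega

end Metric

namespace SpinLSM

/-! ### Coordinate-local interactions -/

section CoordLocal

variable {Λ : Type*} [Fintype Λ] [DecidableEq Λ] {q : ℕ} {L : ℕ} [NeZero L]

/-- **A local interaction of coordinate range `r₀`, strength `J` and term size `V`**: every term is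
supported on its region and Hermitian, lives in `r₀ + 1` consecutive coordinate planes
(`circDist (coord x) (coord y) ≤ r₀` on its region), `Σ_{Z ∋ x} ‖Φ Z‖ ≤ J`, and nonzero terms have
`#Z ≤ V`. For the torus `ℤ/L × ℤ/W` and a range-`R` lattice interaction, `r₀ = R`. These are the
standing hypotheses of BBDF (2019) §2.1.1–2.1.2 (finite range, finite interaction strength) in the
one coordinate direction that the index argument uses (§2.3.2). [cite: BachmannEtAl2019, §2.1.2] -/
structure IsCoordLocal (coord : Λ → ZMod L) (Φ : Interaction Λ q) (r₀ V : ℕ) (J : ℝ) : Prop where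
  /-- every term is supported on its region and Hermitian -/
  isLocal : Φ.IsLocal
  /-- coordinate range `r₀` -/
  range : ∀ Z, Φ Z ≠ 0 → ∀ x ∈ Z, ∀ y ∈ Z, circDist (coord x) (coord y) ≤ r₀
  /-- `J ≥ 0` -/
  strength_nonneg : 0 ≤ J
  /-- local interaction strength `Σ_{Z ∋ x} ‖Φ Z‖ ≤ J` -/
  strength : ∀ x : Λ, ∑ Z ∈ univ.filter (fun Z : Finset Λ => x ∈ Z), ‖Φ Z‖ ≤ J
  /-- `V ≥ 1` -/
  one_le_size : 1 ≤ V
  /-- nonzero terms have at most `V` sites -/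
  size : ∀ Z, Φ Z ≠ 0 → Z.card ≤ V
  /-- no constant term -/
  empty : Φ ∅ = 0

variable {coord : Λ → ZMod L} {Φ : Interaction Λ q} {r₀ V : ℕ} {J : ℝ}

/-- The Lieb–Robinson velocity `v = 2e V (J+1) (r₀+1)` of a coordinate-local interaction (in units
of coordinate planes per unit time, for the decay rate `1/(r₀+1)`). [folklore] -/
def lrVelocity (r₀ V : ℕ) (J : ℝ) : ℝ := 2 * Real.exp 1 * V * (J + 1) * (r₀ + 1)

/-- `v > 0` for `J ≥ 0`, `V ≥ 1`. [folklore] -/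
theorem lrVelocity_pos (hJ : 0 ≤ J) (hV : 1 ≤ V) : 0 < lrVelocity r₀ V J := by
  unfold lrVelocity
  have : (1 : ℝ) ≤ V := by exact_mod_cast hV
  positivity

omit [NeZero L] in
/-- The total interaction strength is at most `|Λ| J`: `Σ_Z ‖Φ Z‖ ≤ |Λ| J` (every nonzero term
contains a site). [folklore] -/
theorem IsCoordLocal.sum_norm_le (h : IsCoordLocal coord Φ r₀ V J) :
    ∑ Z, ‖Φ Z‖ ≤ Fintype.card Λ * J := by
  have h1 : ∑ Z, ‖Φ Z‖ = ∑ Z ∈ univ.filter (fun Z : Finset Λ => ¬ Disjoint Z univ), ‖Φ Z‖ := by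
    rw [Finset.sum_filter]
    refine Finset.sum_congr rfl fun Z _ => ?_
    split_ifs with hZ
    · have hZe : Z = ∅ :=
        Finset.eq_empty_of_forall_notMem fun x hx => Finset.disjoint_left.1 hZ hx (Finset.mem_univ x)
      rw [hZe, h.empty, norm_zero]
    · rfl
  rw [h1]
  refine (sum_filter_not_disjoint_le_sum_sum (fun Z => norm_nonneg (Φ Z)) univ).trans ?_
  calc ∑ y ∈ (univ : Finset Λ), ∑ Z ∈ univ.filter (fun Z : Finset Λ => y ∈ Z), ‖Φ Z‖
      ≤ ∑ _y ∈ (univ : Finset Λ), J := Finset.sum_le_sum fun y _ => h.strength y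
    _ = Fintype.card Λ * J := by rw [Finset.sum_const, Finset.card_univ, nsmul_eq_mul]

omit [NeZero L] in
/-- The terms meeting a region `Y` have total norm `≤ #Y · J`. [folklore] -/
theorem IsCoordLocal.sum_norm_filter_not_disjoint_le (h : IsCoordLocal coord Φ r₀ V J) (Y : Finset Λ) :
    ∑ Z ∈ univ.filter (fun Z : Finset Λ => ¬ Disjoint Z Y), ‖Φ Z‖ ≤ Y.card * J := by
  refine (sum_filter_not_disjoint_le_sum_sum (fun Z => norm_nonneg (Φ Z)) Y).trans ?_
  calc ∑ y ∈ Y, ∑ Z ∈ univ.filter (fun Z : Finset Λ => y ∈ Z), ‖Φ Z‖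
      ≤ ∑ _y ∈ Y, J := Finset.sum_le_sum fun y _ => h.strength y
    _ = Y.card * J := by rw [Finset.sum_const, nsmul_eq_mul]

omit [NeZero L] in
/-- **Locality of the commutator with the Hamiltonian**: for `B ∈ 𝔄_Y`,
`‖[H, B]‖ ≤ 2‖B‖ #Y J`. [folklore] -/
theorem IsCoordLocal.norm_commutator_le (h : IsCoordLocal coord Φ r₀ V J) {B : Op Λ q} {Y : Finset Λ}
    (hB : IsSupportedOn B Y) :
    ‖localHamiltonian Φ univ * B - B * localHamiltonian Φ univ‖ ≤ 2 * ‖B‖ * (Y.card * J) :=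
  (norm_commutator_localHamiltonian_le h.isLocal hB).trans
    (mul_le_mul_of_nonneg_left (h.sum_norm_filter_not_disjoint_le Y) (by positivity))

/-! ### The Lieb–Robinson bound in the coordinate direction -/

/-- The grading of regions by blocks of `r₀ + 1` levels: `⌊(min_{z ∈ Z} δ_Y(z)) / (r₀+1)⌋`
(`0` for the empty region). [folklore] -/
def clevelGrading (coord : Λ → ZMod L) (Y : Finset Λ) (hY : Y.Nonempty) (r₀ : ℕ) (Z : Finset Λ) : ℕ :=
  if hZ : Z.Nonempty then Z.inf' hZ (clevel coord Y hY) / (r₀ + 1) else 0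

omit [Fintype Λ] [DecidableEq Λ] [NeZero L] in
/-- A region of positive grade misses `Y`. [folklore] -/
theorem disjoint_of_clevelGrading_pos {Y : Finset Λ} (hY : Y.Nonempty) {Z : Finset Λ}
    (h : 0 < clevelGrading coord Y hY r₀ Z) : Disjoint Z Y := by
  rw [Finset.disjoint_left]
  intro z hz hzY
  unfold clevelGrading at h
  rw [dif_pos ⟨z, hz⟩] at h
  have h0 : Z.inf' ⟨z, hz⟩ (clevel coord Y hY) = 0 :=
    Nat.eq_zero_of_le_zero ((Finset.inf'_le _ hz).trans (clevel_eq_zero coord hY hzY).le)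
  rw [h0, Nat.zero_div] at h
  exact lt_irrefl 0 h

/-- **The grading axiom**: a term of coordinate range `r₀` meeting `Z` has grade `≥ grade(Z) - 1`.
[folklore] -/
theorem clevelGrading_le_succ (h : IsCoordLocal coord Φ r₀ V J) {Y : Finset Λ} (hY : Y.Nonempty)
    (Z Z' : Finset Λ) (hZ' : Φ Z' ≠ 0) (hZZ' : ¬ Disjoint Z' Z) :
    clevelGrading coord Y hY r₀ Z ≤ clevelGrading coord Y hY r₀ Z' + 1 := by
  obtain ⟨z₀, hz₀', hz₀⟩ := Finset.not_disjoint_iff.1 hZZ'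
  unfold clevelGrading
  rw [dif_pos ⟨z₀, hz₀⟩, dif_pos ⟨z₀, hz₀'⟩]
  -- `min_Z ≤ level z₀ ≤ min_{Z'} + r₀`
  have h1 : Z.inf' ⟨z₀, hz₀⟩ (clevel coord Y hY) ≤ clevel coord Y hY z₀ := Finset.inf'_le _ hz₀
  have h2 : clevel coord Y hY z₀ ≤ Z'.inf' ⟨z₀, hz₀'⟩ (clevel coord Y hY) + r₀ := by
    obtain ⟨z', hz', hmin⟩ := Finset.exists_mem_eq_inf' ⟨z₀, hz₀'⟩ (clevel coord Y hY)
    rw [hmin]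
    have := clevel_le_clevel_add_circDist coord hY z₀ z'
    have hr := h.range Z' hZ' z₀ hz₀' z' hz'
    omega
  calc Z.inf' ⟨z₀, hz₀⟩ (clevel coord Y hY) / (r₀ + 1)
      ≤ (Z'.inf' ⟨z₀, hz₀'⟩ (clevel coord Y hY) + r₀) / (r₀ + 1) := Nat.div_le_div_right (h1.trans h2)
    _ ≤ (Z'.inf' ⟨z₀, hz₀'⟩ (clevel coord Y hY) + (r₀ + 1)) / (r₀ + 1) := Nat.div_le_div_right (by omega)
    _ = Z'.inf' ⟨z₀, hz₀'⟩ (clevel coord Y hY) / (r₀ + 1) + 1 := Nat.add_div_right _ (Nat.succ_pos r₀)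

omit [Fintype Λ] [DecidableEq Λ] [NeZero L] in
/-- The grade of a region at `x₁`-distance `≥ D` from `Y` is `≥ ⌊D/(r₀+1)⌋`. [folklore] -/
theorem div_le_clevelGrading {Y : Finset Λ} (hY : Y.Nonempty) {X : Finset Λ} (hX : X.Nonempty) {D : ℕ}
    (hD : ∀ x ∈ X, ∀ y ∈ Y, D ≤ circDist (coord x) (coord y)) :
    D / (r₀ + 1) ≤ clevelGrading coord Y hY r₀ X := by
  unfold clevelGrading
  rw [dif_pos hX]
  exact Nat.div_le_div_right (Finset.le_inf' _ _ fun x hx => le_clevel coord hY hD hx)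

/-- **Lieb–Robinson bound in the coordinate direction** (Nachtergaele–Sims 2007 §5.1 / BBDF Prop.
2.4, proof; here from the abstract graded bound `norm_comm_heisenbergEvolution_le_exp` of
`LiebRobinsonBoundProofs` with the grading `⌊level/(r₀+1)⌋`): for `A ∈ 𝔄_X` (`X` nonempty),
`B ∈ 𝔄_Y` with `x₁`-distance `≥ D` between `X` and `Y`, and all real times `t`,
`‖[τ_t(A), B]‖ ≤ 2‖A‖‖B‖ #X exp(-(D - r₀)/(r₀+1) + (v/(r₀+1)) |t|)`, `v = 2eV(J+1)(r₀+1)`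
(no commutation hypothesis: for `D ≤ r₀` this is the trivial bound). [cite: NachtergaeleSimsCMP2007, §5.1] -/
theorem coord_lr (h : IsCoordLocal coord Φ r₀ V J) {X Y : Finset Λ} {A B : Op Λ q}
    (hA : IsSupportedOn A X) (hB : IsSupportedOn B Y) (hX : X.Nonempty) (hY : Y.Nonempty)
    {D : ℕ} (hD : ∀ x ∈ X, ∀ y ∈ Y, D ≤ circDist (coord x) (coord y)) (t : ℝ) :
    ‖heisenbergEvolution (localHamiltonian Φ univ) t A * B - B * heisenbergEvolution (localHamiltonian Φ univ) t A‖ ≤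
      2 * ‖A‖ * ‖B‖ * X.card *
        Real.exp (-(((D : ℝ) - r₀) / (r₀ + 1)) + lrVelocity r₀ V J / (r₀ + 1) * |t|) := by
  have hJ := h.strength_nonneg
  have hV1 : (1 : ℝ) ≤ V := by exact_mod_cast h.one_le_size
  have hr : (0 : ℝ) < r₀ + 1 := by positivity
  have hvel : lrVelocity r₀ V J / (r₀ + 1) = 2 * Real.exp 1 * V * (J + 1) := by
    unfold lrVelocity; field_simp
  rw [hvel]
  rcases Nat.lt_or_ge D (r₀ + 1) with hDsmall | hDbig
  · -- trivial bound: the exponent is nonnegative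
    have htriv : ‖heisenbergEvolution (localHamiltonian Φ univ) t A * B -
        B * heisenbergEvolution (localHamiltonian Φ univ) t A‖ ≤ 2 * ‖A‖ * ‖B‖ := by
      have h1 := norm_commutator_le (heisenbergEvolution (localHamiltonian Φ univ) t A) B
      rwa [norm_heisenbergEvolution_holds (localHamiltonian_isHermitian h.isLocal _) t A] at h1
    refine htriv.trans ?_
    have hX1 : (1 : ℝ) ≤ X.card := by exact_mod_cast hX.card_pos
    have hexp : (1 : ℝ) ≤ Real.exp (-(((D : ℝ) - r₀) / (r₀ + 1)) + 2 * Real.exp 1 * V * (J + 1) * |t|) := by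
      refine Real.one_le_exp ?_
      have h1 : -(((D : ℝ) - r₀) / (r₀ + 1)) ≥ 0 := by
        rw [ge_iff_le, neg_nonneg, div_le_iff₀ hr, zero_mul, sub_nonpos]
        exact_mod_cast (by omega : D ≤ r₀)
      have h2 : 0 ≤ 2 * Real.exp 1 * V * (J + 1) * |t| := by positivity
      linarith
    calc 2 * ‖A‖ * ‖B‖ = 2 * ‖A‖ * ‖B‖ * 1 * 1 := by ring
      _ ≤ 2 * ‖A‖ * ‖B‖ * X.card *
          Real.exp (-(((D : ℝ) - r₀) / (r₀ + 1)) + 2 * Real.exp 1 * V * (J + 1) * |t|) := by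
          gcongr
  · -- the graded Lieb–Robinson bound with `μ = 1`
    have hgrade : 0 < clevelGrading coord Y hY r₀ X :=
      lt_of_lt_of_le (Nat.div_pos hDbig (Nat.succ_pos r₀)) (div_le_clevelGrading hY hX hD)
    have hJ1 : ∀ x : Λ, ∑ Z ∈ univ.filter (fun Z : Finset Λ => x ∈ Z), ‖Φ Z‖ ≤ J + 1 :=
      fun x => (h.strength x).trans (by linarith)
    have hlr := norm_comm_heisenbergEvolution_le_exp h.isLocal hA hB (clevelGrading coord Y hY r₀)
      (fun Z hZ => disjoint_of_clevelGrading_pos hY hZ)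
      (fun Z Z' hZ' hZZ' => clevelGrading_le_succ h hY Z Z' hZ' hZZ') hgrade (by linarith) hJ1
      h.one_le_size h.size zero_le_one t
    refine hlr.trans ?_
    have hXV : (X.card : ℝ) / V ≤ X.card := div_le_self (Nat.cast_nonneg _) hV1
    have hk : ((D : ℝ) - r₀) / (r₀ + 1) ≤ (clevelGrading coord Y hY r₀ X : ℕ) := by
      have h1 : D / (r₀ + 1) ≤ clevelGrading coord Y hY r₀ X := div_le_clevelGrading hY hX hD
      have h2 : ((D : ℝ) - r₀) / (r₀ + 1) ≤ ((D / (r₀ + 1) : ℕ) : ℝ) := by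
        rw [div_le_iff₀ hr]
        have h3 := Nat.div_add_mod D (r₀ + 1)
        have h4 := Nat.mod_lt D (Nat.succ_pos r₀)
        have h5 : ((D : ℕ) : ℝ) = ((r₀ + 1) * (D / (r₀ + 1)) + D % (r₀ + 1) : ℕ) := by rw [h3]
        push_cast at h5 ⊢
        have h6 : ((D % (r₀ + 1) : ℕ) : ℝ) ≤ r₀ := by exact_mod_cast Nat.lt_succ_iff.1 h4
        nlinarith
      exact h2.trans (by exact_mod_cast h1)
    have hexp : Real.exp (-(1 * (clevelGrading coord Y hY r₀ X : ℝ)) + 2 * Real.exp 1 * V * (J + 1) * |t|) ≤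
        Real.exp (-(((D : ℝ) - r₀) / (r₀ + 1)) + 2 * Real.exp 1 * V * (J + 1) * |t|) :=
      Real.exp_le_exp.2 (by linarith)
    calc 2 * ‖A‖ * ‖B‖ * (X.card / V) *
          Real.exp (-(1 * (clevelGrading coord Y hY r₀ X : ℝ)) + 2 * Real.exp 1 * V * (J + 1) * |t|)
        ≤ 2 * ‖A‖ * ‖B‖ * X.card *
          Real.exp (-(((D : ℝ) - r₀) / (r₀ + 1)) + 2 * Real.exp 1 * V * (J + 1) * |t|) := by
          gcongr

/-- The coordinate Lieb–Robinson bound in the format of `clustering_of_commutator_bounds`: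
`‖[τ_t(A), B]‖ ≤ 2‖A‖‖B‖ #X e^{-μ(D' - v|t|)}` with `μ = 1/(r₀+1)`, `D' = D - r₀`,
`v = lrVelocity`. [folklore] -/
theorem coord_lr' (h : IsCoordLocal coord Φ r₀ V J) {X Y : Finset Λ} {A B : Op Λ q}
    (hA : IsSupportedOn A X) (hB : IsSupportedOn B Y) (hX : X.Nonempty) (hY : Y.Nonempty)
    {D : ℕ} (hD : ∀ x ∈ X, ∀ y ∈ Y, D ≤ circDist (coord x) (coord y)) (t : ℝ) :
    ‖heisenbergEvolution (localHamiltonian Φ univ) t A * B - B * heisenbergEvolution (localHamiltonian Φ univ) t A‖ ≤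
      2 * ‖A‖ * ‖B‖ * X.card *
        Real.exp (-(1 / ((r₀ : ℝ) + 1)) * (((D : ℝ) - r₀) - lrVelocity r₀ V J * |t|)) := by
  refine (coord_lr h hA hB hX hY hD t).trans (le_of_eq ?_)
  congr 1
  have hr : (r₀ : ℝ) + 1 ≠ 0 := by positivity
  field_simp
  ring

/-! ### Exponential clustering in the coordinate direction (BBDF Assumption (v)) -/

/-- **Exponential clustering of the unique gapped ground state in the coordinate direction**
(BBDF Assumption (v), via Prop. 2.4: "exponential clustering was proved in [Hastings 2004], see
also [Nachtergaele–Sims 2007]"; here from `coord_lr` and the generic Hastings–Koma assembly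
`clustering_of_commutator_bounds`). For `A ∈ 𝔄_X`, `B ∈ 𝔄_Y` commuting, `X`, `Y` nonempty, with
`x₁`-distance `≥ D` and `D - r₀ ≥ max(2v, 1)`:
`|⟨ψ,ABψ⟩ - ⟨ψ,Aψ⟩⟨ψ,Bψ⟩| ≤ (2 + 4J + 8(r₀+1)/v + 8v/γ) ‖A‖‖B‖ max(#X,#Y) e^{-(D-r₀)/ξ}`,
`ξ = max(8(r₀+1), 4v/γ)`, `v = lrVelocity`. [cite: BachmannEtAl2019, Proposition 2.4 (Assumption (v))] -/
theorem coord_clustering (h : IsCoordLocal coord Φ r₀ V J) {γ : ℝ} (hγ : 0 < γ)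
    (hgap : (localHamiltonian Φ univ).HasSpectralGap γ) {ψ : TensorIndex Λ q → ℂ}
    (hψ : (localHamiltonian Φ univ).IsGroundStateVector ψ) (hψ1 : star ψ ⬝ᵥ ψ = 1)
    {X Y : Finset Λ} {A B : Op Λ q} (hA : IsSupportedOn A X) (hB : IsSupportedOn B Y)
    (hAB : Commute A B) (hX : X.Nonempty) (hY : Y.Nonempty) {D : ℕ}
    (hD : ∀ x ∈ X, ∀ y ∈ Y, D ≤ circDist (coord x) (coord y))
    (hDlarge : max (2 * lrVelocity r₀ V J) 1 ≤ (D : ℝ) - r₀) :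
    ‖opExpect (A * B) ψ - opExpect A ψ * opExpect B ψ‖ ≤
      (2 + 4 * J + 4 * 2 / (lrVelocity r₀ V J * (1 / ((r₀ : ℝ) + 1))) + 8 * lrVelocity r₀ V J / γ) *
        ‖A‖ * ‖B‖ * ((max X.card Y.card : ℕ) : ℝ) *
        Real.exp (-((D : ℝ) - r₀) / max (8 / (1 / ((r₀ : ℝ) + 1))) (4 * lrVelocity r₀ V J / γ)) := by
  have hJ := h.strength_nonneg
  have hv := lrVelocity_pos (r₀ := r₀) hJ h.one_le_size
  have hH := localHamiltonian_isHermitian h.isLocal (univ : Finset Λ)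
  have hm0 : (0 : ℝ) ≤ ((max X.card Y.card : ℕ) : ℝ) := Nat.cast_nonneg _
  have hm1 : (1 : ℝ) ≤ ((max X.card Y.card : ℕ) : ℝ) := by
    have : 1 ≤ max X.card Y.card := le_max_of_le_left hX.card_pos
    exact_mod_cast this
  have hμ : (0 : ℝ) < 1 / ((r₀ : ℝ) + 1) := by positivity
  refine clustering_of_commutator_bounds hH hγ (by norm_num) hμ hv hJ hm1 hm0 le_rfl hgap hψ hψ1
    hAB ?_ ?_ hDlarge
  · -- Lipschitz input
    refine (h.norm_commutator_le hB).trans ?_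
    have hYle : (Y.card : ℝ) ≤ ((max X.card Y.card : ℕ) : ℝ) := by exact_mod_cast le_max_right _ _
    have hB0 : 0 ≤ 2 * ‖B‖ := by positivity
    exact mul_le_mul_of_nonneg_left (mul_le_mul_of_nonneg_right hYle hJ) hB0
  · -- Lieb–Robinson input (roles of `A`, `B` exchanged)
    intro t
    have hD' : ∀ y ∈ Y, ∀ x ∈ X, D ≤ circDist (coord y) (coord x) := fun y hy x hx => by
      rw [circDist_comm]; exact hD x hx y hy
    refine (coord_lr' h hB hA hY hX hD' t).trans ?_
    have hYle : (Y.card : ℝ) ≤ ((max X.card Y.card : ℕ) : ℝ) := by exact_mod_cast le_max_right _ _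
    gcongr

end CoordLocal

/-! ### Boundary currents of the `U(1)` charge (spin `1/2`) -/

section Currents

variable {Λ : Type*} [Fintype Λ] [DecidableEq Λ]
variable {Φ : Interaction Λ 2}

/-- **A `U(1)`-invariant term commutes with the charge of any region containing its support**
(`Q_S = Q_Z + Q_{S∖Z}`, the second summand having disjoint support). BBDF (2019) §2.1.4 (charge
conservation `[Φ_X, Q_Y] = 0` for `X ⊆ Y`). [folklore] -/
theorem commute_term_regionCharge_of_subset (hΦ : Φ.IsLocal) (hU1 : ∀ Z, Commute (Φ Z) (regionCharge Z))
    {Z S : Finset Λ} (h : Z ⊆ S) : Commute (Φ Z) (regionCharge S) := by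
  have hsplit : regionCharge S = regionCharge Z + regionCharge (S \ Z) := by
    rw [← regionCharge_union Finset.disjoint_sdiff, Finset.union_sdiff_of_subset h]
  rw [hsplit]
  exact (hU1 Z).add_right (commute_of_mem_supportedSubalgebra Finset.disjoint_sdiff
    (hΦ.isSupportedOn Z) (regionCharge_mem_supportedSubalgebra _))

/-- A term commutes with the charge of a region disjoint from its support. [folklore] -/
theorem commute_term_regionCharge_of_disjoint (hΦ : Φ.IsLocal) {Z S : Finset Λ} (h : Disjoint Z S) :
    Commute (Φ Z) (regionCharge S) :=
  commute_of_mem_supportedSubalgebra h (hΦ.isSupportedOn Z) (regionCharge_mem_supportedSubalgebra _)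

/-- The regions **crossing the boundary** of `S`: meeting both `S` and its complement. BBDF (2019)
§2.2, Assumption (ii) / Prop. 2.4 (the terms carrying the current through `∂S`). [folklore] -/
def crossingTerms (S : Finset Λ) : Finset (Finset Λ) :=
  univ.filter fun Z => ¬ Z ⊆ S ∧ ¬ Disjoint Z S

/-- Membership in `crossingTerms`. [folklore] -/
@[simp] theorem mem_crossingTerms {S Z : Finset Λ} : Z ∈ crossingTerms S ↔ ¬ Z ⊆ S ∧ ¬ Disjoint Z S := by
  simp [crossingTerms]

/-- Crossing regions are nonempty. [folklore] -/
theorem nonempty_of_mem_crossingTerms {S Z : Finset Λ} (h : Z ∈ crossingTerms S) : Z.Nonempty := by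
  obtain ⟨z, hz, -⟩ := Finset.not_disjoint_iff.1 (mem_crossingTerms.1 h).2
  exact ⟨z, hz⟩

/-- **`[Q_S, H]` is carried by the crossing terms**: `Q_S H - H Q_S = Σ_{Z crossing ∂S} (Q_S Φ_Z - Φ_Z Q_S)`
for a `U(1)`-invariant local interaction. BBDF (2019) Prop. 2.4 (proof). [folklore] -/
theorem regionCharge_commutator_localHamiltonian (hΦ : Φ.IsLocal) (hU1 : ∀ Z, Commute (Φ Z) (regionCharge Z))
    (S : Finset Λ) :
    regionCharge S * localHamiltonian Φ univ - localHamiltonian Φ univ * regionCharge S =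
      ∑ Z ∈ crossingTerms S, (regionCharge S * Φ Z - Φ Z * regionCharge S) := by
  rw [localHamiltonian, Finset.powerset_univ, Finset.mul_sum, Finset.sum_mul, ← Finset.sum_sub_distrib,
    crossingTerms, Finset.sum_filter]
  refine Finset.sum_congr rfl fun Z _ => ?_
  split_ifs with hZ
  · rfl
  · rw [not_and_or, not_not, not_not] at hZ
    rcases hZ with h | h
    · exact sub_eq_zero.2 (commute_term_regionCharge_of_subset hΦ hU1 h).symm.eq
    · exact sub_eq_zero.2 (commute_term_regionCharge_of_disjoint hΦ h).symm.eq

/-- Only the part of the charge inside the term's support fails to commute: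
`Q_S Φ_Z - Φ_Z Q_S = Q_{S∩Z} Φ_Z - Φ_Z Q_{S∩Z}`. [folklore] -/
theorem regionCharge_commutator_term_eq_inter (hΦ : Φ.IsLocal) (S Z : Finset Λ) :
    regionCharge S * Φ Z - Φ Z * regionCharge S =
      regionCharge (S ∩ Z) * Φ Z - Φ Z * regionCharge (S ∩ Z) := by
  have hsplit : regionCharge S = regionCharge (S ∩ Z) + regionCharge (S \ Z) := by
    rw [← regionCharge_union (Finset.disjoint_of_subset_left Finset.inter_subset_right Finset.disjoint_sdiff),
      Finset.union_comm, Finset.sdiff_union_inter]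
  have hc : Commute (Φ Z) (regionCharge (S \ Z)) :=
    commute_term_regionCharge_of_disjoint hΦ Finset.disjoint_sdiff
  rw [hsplit, Matrix.add_mul, Matrix.mul_add, hc.symm.eq]
  abel

/-- **The current of the charge `Q_S` through the window `P`**: the part
`J(S,P) = Σ_{Z crossing ∂S, Z ⊆ P} (Q_S Φ_Z - Φ_Z Q_S)` of `[Q_S, H]` carried by the terms inside `P`
(BBDF Prop. 2.4: `[Q,H] = J₋ + J₊`, "a sum of two terms supported in the strips `∂^R_±`").
[cite: BachmannEtAl2019, Proposition 2.4 (proof)] -/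
def windowCurrent (Φ : Interaction Λ 2) (S P : Finset Λ) : Op Λ 2 :=
  ∑ Z ∈ (crossingTerms S).filter (fun Z => Z ⊆ P), (regionCharge S * Φ Z - Φ Z * regionCharge S)

/-- The window current lies in `𝔄_P`. [folklore] -/
theorem windowCurrent_mem (hΦ : Φ.IsLocal) (S P : Finset Λ) : windowCurrent Φ S P ∈ supportedSubalgebra P := by
  unfold windowCurrent
  refine Subalgebra.sum_mem _ fun Z hZ => ?_
  rw [Finset.mem_filter] at hZ
  rw [regionCharge_commutator_term_eq_inter hΦ]
  have hQ : regionCharge (S ∩ Z) ∈ supportedSubalgebra P :=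
    regionCharge_mem_supportedSubalgebra_of_subset (Finset.inter_subset_right.trans hZ.2)
  have hT : Φ Z ∈ supportedSubalgebra P := supportedSubalgebra_mono hZ.2 (hΦ.isSupportedOn Z)
  exact Subalgebra.sub_mem _ (Subalgebra.mul_mem _ hQ hT) (Subalgebra.mul_mem _ hT hQ)

/-- The window current is anti-Hermitian. [folklore] -/
theorem conjTranspose_windowCurrent (hΦ : Φ.IsLocal) (S P : Finset Λ) :
    (windowCurrent Φ S P)ᴴ = -windowCurrent Φ S P := by
  unfold windowCurrent
  rw [conjTranspose_sum, ← Finset.sum_neg_distrib]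
  refine Finset.sum_congr rfl fun Z _ => ?_
  rw [conjTranspose_sub, conjTranspose_mul, conjTranspose_mul, (hΦ.isHermitian Z).eq,
    (regionCharge_isHermitian S).eq, neg_sub]

/-- Norm of one crossing commutator: `‖Q_S Φ_Z - Φ_Z Q_S‖ ≤ 2 V ‖Φ Z‖` when nonzero terms have
`#Z ≤ V`. [folklore] -/
theorem norm_regionCharge_commutator_term_le (hΦ : Φ.IsLocal) {V : ℕ} (hV : ∀ Z, Φ Z ≠ 0 → Z.card ≤ V)
    (S Z : Finset Λ) : ‖regionCharge S * Φ Z - Φ Z * regionCharge S‖ ≤ 2 * V * ‖Φ Z‖ := by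
  by_cases h0 : Φ Z = 0
  · rw [h0, Matrix.mul_zero, Matrix.zero_mul, sub_self, norm_zero, mul_zero]
  rw [regionCharge_commutator_term_eq_inter hΦ]
  refine (norm_commutator_le _ _).trans ?_
  have h1 : ‖regionCharge (S ∩ Z)‖ ≤ V := by
    refine (norm_regionCharge_le _).trans ?_
    exact_mod_cast (Finset.card_le_card Finset.inter_subset_right).trans (hV Z h0)
  have := norm_nonneg (Φ Z)
  nlinarith [norm_nonneg (regionCharge (S ∩ Z))]

/-- **Norm bound of the window current**: `‖J(S,P)‖ ≤ 2V · #P · J` for an interaction of term size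
`V` and strength `Σ_{Z∋x}‖Φ Z‖ ≤ J`. [folklore] -/
theorem norm_windowCurrent_le (hΦ : Φ.IsLocal) {V : ℕ} (hV : ∀ Z, Φ Z ≠ 0 → Z.card ≤ V) {J : ℝ}
    (hJ : ∀ x : Λ, ∑ Z ∈ univ.filter (fun Z : Finset Λ => x ∈ Z), ‖Φ Z‖ ≤ J) (S P : Finset Λ) :
    ‖windowCurrent Φ S P‖ ≤ 2 * V * (P.card * J) := by
  unfold windowCurrent
  refine (norm_sum_le _ _).trans ?_
  calc ∑ Z ∈ (crossingTerms S).filter (fun Z => Z ⊆ P), ‖regionCharge S * Φ Z - Φ Z * regionCharge S‖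
      ≤ ∑ Z ∈ (crossingTerms S).filter (fun Z => Z ⊆ P), 2 * V * ‖Φ Z‖ :=
        Finset.sum_le_sum fun Z _ => norm_regionCharge_commutator_term_le hΦ hV S Z
    _ = 2 * V * ∑ Z ∈ (crossingTerms S).filter (fun Z => Z ⊆ P), ‖Φ Z‖ := by rw [Finset.mul_sum]
    _ ≤ 2 * V * ∑ Z ∈ univ.filter (fun Z : Finset Λ => ¬ Disjoint Z P), ‖Φ Z‖ := by
        refine mul_le_mul_of_nonneg_left (Finset.sum_le_sum_of_subset_of_nonneg (fun Z hZ => ?_)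
          (fun _ _ _ => norm_nonneg _)) (by positivity)
        rw [Finset.mem_filter] at hZ ⊢
        refine ⟨Finset.mem_univ _, fun hd => ?_⟩
        obtain ⟨z, hz⟩ := nonempty_of_mem_crossingTerms hZ.1
        exact Finset.disjoint_left.1 hd hz (hZ.2 hz)
    _ ≤ 2 * V * (P.card * J) := by
        refine mul_le_mul_of_nonneg_left ?_ (by positivity)
        refine (sum_filter_not_disjoint_le_sum_sum (fun Z => norm_nonneg (Φ Z)) P).trans ?_
        calc ∑ y ∈ P, ∑ Z ∈ univ.filter (fun Z : Finset Λ => y ∈ Z), ‖Φ Z‖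
            ≤ ∑ _y ∈ P, J := Finset.sum_le_sum fun y _ => hJ y
          _ = P.card * J := by rw [Finset.sum_const, nsmul_eq_mul]

/-- **Decomposition of the charge–Hamiltonian commutator into two window currents** (BBDF Prop.
2.4, proof: `[Q, H] = J_- + J_+`): if every NONZERO term crossing `∂S` lies in the window `P₁` or
in the window `P₂`, and these are disjoint, then `[Q_S, H] = J(S,P₁) + J(S,P₂)`.
[cite: BachmannEtAl2019, Proposition 2.4 (proof)] -/
theorem regionCharge_commutator_eq_add_windowCurrent (hΦ : Φ.IsLocal) (hU1 : ∀ Z, Commute (Φ Z) (regionCharge Z))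
    {S P₁ P₂ : Finset Λ} (hP : Disjoint P₁ P₂)
    (hcover : ∀ Z ∈ crossingTerms S, Φ Z ≠ 0 → Z ⊆ P₁ ∨ Z ⊆ P₂) :
    regionCharge S * localHamiltonian Φ univ - localHamiltonian Φ univ * regionCharge S =
      windowCurrent Φ S P₁ + windowCurrent Φ S P₂ := by
  rw [regionCharge_commutator_localHamiltonian hΦ hU1, windowCurrent, windowCurrent,
    ← Finset.sum_filter_add_sum_filter_not (crossingTerms S) (fun Z => Z ⊆ P₁)]
  congr 1
  rw [← Finset.sum_filter_add_sum_filter_not ((crossingTerms S).filter fun Z => ¬ Z ⊆ P₁) (fun Z => Z ⊆ P₂)]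
  have hzero : ∑ Z ∈ ((crossingTerms S).filter fun Z => ¬ Z ⊆ P₁).filter (fun Z => ¬ Z ⊆ P₂),
      (regionCharge S * Φ Z - Φ Z * regionCharge S) = 0 := by
    refine Finset.sum_eq_zero fun Z hZ => ?_
    simp only [Finset.mem_filter] at hZ
    have h0 : Φ Z = 0 := by
      by_contra h0
      rcases hcover Z hZ.1.1 h0 with h | h
      · exact hZ.1.2 h
      · exact hZ.2 h
    rw [h0, Matrix.mul_zero, Matrix.zero_mul, sub_self]
  rw [hzero, add_zero]
  refine Finset.sum_congr ?_ fun Z _ => rfl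
  ext Z
  simp only [Finset.mem_filter]
  constructor
  · rintro ⟨⟨hZ, -⟩, h2⟩; exact ⟨hZ, h2⟩
  · rintro ⟨hZ, h2⟩
    refine ⟨⟨hZ, fun h1 => ?_⟩, h2⟩
    obtain ⟨z, hz⟩ := nonempty_of_mem_crossingTerms hZ
    exact Finset.disjoint_left.1 hP (h1 hz) (h2 hz)

end Currents

/-! ### The Gaussian quasi-adiabatic operators `K̃ = i𝓖^H(J)` and `K = i𝓖^{H_B}(J)` -/

section Dressing

variable {Λ : Type*} [Fintype Λ] [DecidableEq Λ] {L : ℕ} [NeZero L]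
variable {coord : Λ → ZMod L} {Φ : Interaction Λ 2} {r₀ V : ℕ} {J : ℝ}

/-- **`K̃ = i𝓖_a^H(J)`**: the Gaussian dressing of the window current `J = J(S,P)` by the full
Hamiltonian (BBDF Prop. 2.4, eq. (2.12), with Hastings' Gaussian filter).
[cite: BachmannEtAl2019, Proposition 2.4 (proof, eq. (2.12))] -/
def kTildeG (a : ℝ) (Φ : Interaction Λ 2) (S P : Finset Λ) : Op Λ 2 :=
  I • gqaGenerator a (localHamiltonian Φ univ) (windowCurrent Φ S P)

/-- **The strictly local approximant `K = i𝓖_a^{H_B}(J)`**, generated by the local Hamiltonian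
`H_B = Σ_{Z ⊆ B} Φ Z` of a region `B ⊇ P` (BBDF Prop. 2.4: approximants `K_± ∈ 𝒜_{∂_±}`).
[cite: BachmannEtAl2019, Proposition 2.4 (proof)] -/
def kLocG (a : ℝ) (Φ : Interaction Λ 2) (S P B : Finset Λ) : Op Λ 2 :=
  I • gqaGenerator a (localHamiltonian Φ B) (windowCurrent Φ S P)

omit [NeZero L] in
/-- `K̃` is Hermitian. [folklore] -/
theorem isHermitian_kTildeG (hΦ : Φ.IsLocal) (a : ℝ) (S P : Finset Λ) : (kTildeG a Φ S P).IsHermitian :=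
  isHermitian_I_smul_gqaGenerator (localHamiltonian_isHermitian hΦ _) (conjTranspose_windowCurrent hΦ S P) a

omit [NeZero L] in
/-- `K` is Hermitian. [folklore] -/
theorem isHermitian_kLocG (hΦ : Φ.IsLocal) (a : ℝ) (S P B : Finset Λ) : (kLocG a Φ S P B).IsHermitian :=
  isHermitian_I_smul_gqaGenerator (localHamiltonian_isHermitian hΦ _) (conjTranspose_windowCurrent hΦ S P) a

omit [NeZero L] in
/-- **`K` is strictly local**: `K ∈ 𝔄_B` for `P ⊆ B`. [folklore] -/
theorem kLocG_mem (hΦ : Φ.IsLocal) (a : ℝ) {S P B : Finset Λ} (hPB : P ⊆ B) :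
    kLocG a Φ S P B ∈ supportedSubalgebra B := by
  unfold kLocG
  refine Subalgebra.smul_mem _ ?_ _
  exact gqaGenerator_mem_subalgebra _ (localHamiltonian_isHermitian hΦ _)
    (localHamiltonian_mem_supportedSubalgebra hΦ B) (supportedSubalgebra_mono hPB (windowCurrent_mem hΦ S P)) a

omit [NeZero L] in
/-- Norm bound `‖K‖ ≤ (√(π/a)/2) ‖J(S,P)‖`. [folklore] -/
theorem norm_kLocG_le (hΦ : Φ.IsLocal) {a : ℝ} (ha : 0 < a) (S P B : Finset Λ) :
    ‖kLocG a Φ S P B‖ ≤ Real.sqrt (Real.pi / a) / 2 * ‖windowCurrent Φ S P‖ := by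
  unfold kLocG
  rw [norm_smul, Complex.norm_I, one_mul]
  exact norm_gqaGenerator_le (localHamiltonian_isHermitian hΦ _) ha _

omit [NeZero L] in
/-- Norm bound `‖K̃‖ ≤ (√(π/a)/2) ‖J(S,P)‖`. [folklore] -/
theorem norm_kTildeG_le (hΦ : Φ.IsLocal) {a : ℝ} (ha : 0 < a) (S P : Finset Λ) :
    ‖kTildeG a Φ S P‖ ≤ Real.sqrt (Real.pi / a) / 2 * ‖windowCurrent Φ S P‖ := by
  unfold kTildeG
  rw [norm_smul, Complex.norm_I, one_mul]
  exact norm_gqaGenerator_le (localHamiltonian_isHermitian hΦ _) ha _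

omit [NeZero L] in
/-- **The unique gapped ground state is an APPROXIMATE eigenvector of `Q_S - K̃₁ - K̃₂`** (the
Gaussian version of BBDF Prop. 2.4, "`Ω` is an exact eigenvector of `Q - K̃_+ - K̃_-`"): with
`q = ⟨ψ, (Q_S - K̃₁ - K̃₂)ψ⟩`, `‖(Q_S - K̃₁ - K̃₂)ψ - qψ‖₂ ≤ e^{-γ²/(4a)} #S`, from
`gqaGenerator_approx_intertwines'` and `[Q_S,H] = J₁ + J₂`.
[cite: HastingsPRB2004, §II] -/
theorem eucNorm_regionCharge_sub_kTildeG_mulVec_le (hΦ : Φ.IsLocal) (hU1 : ∀ Z, Commute (Φ Z) (regionCharge Z))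
    {S P₁ P₂ : Finset Λ} (hP : Disjoint P₁ P₂)
    (hcover : ∀ Z ∈ crossingTerms S, Φ Z ≠ 0 → Z ⊆ P₁ ∨ Z ⊆ P₂)
    {γ g a : ℝ} (hγ : 0 < γ) (hγg : γ ≤ g) (ha : 0 < a) (hgap : (localHamiltonian Φ univ).HasSpectralGap g)
    {ψ : TensorIndex Λ 2 → ℂ} (hψ : (localHamiltonian Φ univ).IsGroundStateVector ψ) (hψ1 : star ψ ⬝ᵥ ψ = 1) :
    eucNorm ((regionCharge S - kTildeG a Φ S P₁ - kTildeG a Φ S P₂) *ᵥ ψ -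
        (star ψ ⬝ᵥ ((regionCharge S - kTildeG a Φ S P₁ - kTildeG a Φ S P₂) *ᵥ ψ)) • ψ) ≤
      Real.exp (-γ ^ 2 / (4 * a)) * S.card := by
  have hH := localHamiltonian_isHermitian hΦ (univ : Finset Λ)
  have key := gqaGenerator_approx_intertwines' hH hγ hγg ha hgap hψ hψ1 (regionCharge S)
  have e : regionCharge S - I • gqaGenerator a (localHamiltonian Φ univ)
      (regionCharge S * localHamiltonian Φ univ - localHamiltonian Φ univ * regionCharge S) =
      regionCharge S - kTildeG a Φ S P₁ - kTildeG a Φ S P₂ := by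
    rw [regionCharge_commutator_eq_add_windowCurrent hΦ hU1 hP hcover, gqaGenerator_add hH ha, smul_add,
      kTildeG, kTildeG]
    abel
  rw [e] at key
  exact key.trans (mul_le_mul_of_nonneg_left (norm_regionCharge_le S) (Real.exp_nonneg _))

omit [NeZero L] in
/-- The full Hamiltonian minus the local one is the sum of the terms not inside `B`. [folklore] -/
theorem localHamiltonian_univ_sub (Φ : Interaction Λ 2) (B : Finset Λ) :
    localHamiltonian Φ univ - localHamiltonian Φ B = ∑ Z ∈ univ.filter (fun Z : Finset Λ => ¬ Z ⊆ B), Φ Z := by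
  rw [localHamiltonian, localHamiltonian, Finset.powerset_univ, sub_eq_iff_eq_add,
    ← Finset.sum_filter_add_sum_filter_not univ (fun Z : Finset Λ => ¬ Z ⊆ B)]
  congr 1
  refine Finset.sum_congr ?_ fun Z _ => rfl
  ext Z
  simp

/-- **Locality of the Gaussian quasi-adiabatic operator `K`** (BBDF Prop. 2.4: `K̃_± = K_± + O(·)`,
here with Gaussian tails), quantitatively: if every NONZERO term of `H` not inside `B` keeps
`x₁`-distance `≥ R` from the (nonempty) window `P`, then for every `T > 0`,
`‖K - K̃‖ ≤ η T √(π/a)/2 + 2‖J‖ e^{-aT²}/(2aT)` with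
`η = |Λ| J · 2V ‖J‖ e^{-(R - r₀)/(r₀+1) + vT/(r₀+1)}`, `v = lrVelocity`
(Lieb–Robinson for each discarded term, `norm_gqaGenerator_sub_gqaGenerator_le_of_commutator`).
[cite: BachmannEtAl2019, Proposition 2.4 (proof)] -/
theorem norm_kLocG_sub_kTildeG_le (h : IsCoordLocal coord Φ r₀ V J) {a : ℝ} (ha : 0 < a)
    {S P B : Finset Λ} (hPne : P.Nonempty) {R : ℕ}
    (hR : ∀ Z, Φ Z ≠ 0 → ¬ Z ⊆ B → ∀ z ∈ Z, ∀ p ∈ P, R ≤ circDist (coord z) (coord p))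
    {T : ℝ} (hT : 0 < T) :
    ‖kLocG a Φ S P B - kTildeG a Φ S P‖ ≤
      (Fintype.card Λ * J * (2 * V * ‖windowCurrent Φ S P‖ *
          Real.exp (-(((R : ℝ) - r₀) / (r₀ + 1)) + lrVelocity r₀ V J / (r₀ + 1) * T))) *
        T * (Real.sqrt (Real.pi / a) / 2) +
      2 * ‖windowCurrent Φ S P‖ * (Real.exp (-a * T ^ 2) / (2 * a * T)) := by
  set Jc := windowCurrent Φ S P with hJc
  have hΦ := h.isLocal
  have hH := localHamiltonian_isHermitian hΦ (univ : Finset Λ)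
  have hHB := localHamiltonian_isHermitian hΦ B
  have hJ0 := h.strength_nonneg
  have hv := lrVelocity_pos (r₀ := r₀) hJ0 h.one_le_size
  -- `K - K̃ = i(𝓖^{H_B}(J) - 𝓖^H(J))`
  have e : kLocG a Φ S P B - kTildeG a Φ S P =
      I • (gqaGenerator a (localHamiltonian Φ B) Jc - gqaGenerator a (localHamiltonian Φ univ) Jc) := by
    rw [kLocG, kTildeG, smul_sub]
  rw [e, norm_smul, Complex.norm_I, one_mul, norm_sub_rev]
  -- per-term bound, uniform in `|u| ≤ T`
  set η₁ : ℝ := 2 * V * ‖Jc‖ * Real.exp (-(((R : ℝ) - r₀) / (r₀ + 1)) + lrVelocity r₀ V J / (r₀ + 1) * T)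
    with hη₁
  have hη₁0 : 0 ≤ η₁ := by positivity
  have hterm : ∀ u : ℝ, |u| ≤ T → ∀ Z ∈ univ.filter (fun Z : Finset Λ => ¬ Z ⊆ B),
      ‖heisenbergEvolution (localHamiltonian Φ univ) u (Φ Z) * Jc - Jc * heisenbergEvolution (localHamiltonian Φ univ) u (Φ Z)‖ ≤
        η₁ * ‖Φ Z‖ := by
    intro u hu Z hZ
    rw [Finset.mem_filter] at hZ
    by_cases h0 : Φ Z = 0
    · have hev : heisenbergEvolution (localHamiltonian Φ univ) u (Φ Z) = 0 := by
        rw [h0, heisenbergEvolution, Matrix.mul_zero, Matrix.zero_mul]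
      rw [hev, Matrix.zero_mul, Matrix.mul_zero, sub_self, norm_zero, h0, norm_zero, mul_zero]
    have hZne : Z.Nonempty := by
      by_contra hne
      rw [Finset.not_nonempty_iff_eq_empty] at hne
      exact h0 (hne ▸ h.empty)
    have hlr := coord_lr h (hΦ.isSupportedOn Z) (windowCurrent_mem hΦ S P) hZne hPne (hR Z h0 hZ.2) u
    refine hlr.trans ?_
    rw [hη₁]
    have hcard : (Z.card : ℝ) ≤ V := by exact_mod_cast h.size Z h0
    have hexp : Real.exp (-(((R : ℝ) - r₀) / (r₀ + 1)) + lrVelocity r₀ V J / (r₀ + 1) * |u|) ≤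
        Real.exp (-(((R : ℝ) - r₀) / (r₀ + 1)) + lrVelocity r₀ V J / (r₀ + 1) * T) := by
      refine Real.exp_le_exp.2 ?_
      have := mul_le_mul_of_nonneg_left hu (div_nonneg hv.le (by positivity : (0:ℝ) ≤ r₀ + 1))
      linarith
    calc 2 * ‖Φ Z‖ * ‖Jc‖ * Z.card * Real.exp (-(((R : ℝ) - r₀) / (r₀ + 1)) + lrVelocity r₀ V J / (r₀ + 1) * |u|)
        ≤ 2 * ‖Φ Z‖ * ‖Jc‖ * V * Real.exp (-(((R : ℝ) - r₀) / (r₀ + 1)) + lrVelocity r₀ V J / (r₀ + 1) * T) := by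
          gcongr
      _ = 2 * V * ‖Jc‖ * Real.exp (-(((R : ℝ) - r₀) / (r₀ + 1)) + lrVelocity r₀ V J / (r₀ + 1) * T) * ‖Φ Z‖ := by
          ring
  -- the commutator with the difference of the Hamiltonians
  have hη : ∀ u : ℝ, |u| ≤ T →
      ‖heisenbergEvolution (localHamiltonian Φ univ) u (localHamiltonian Φ univ - localHamiltonian Φ B) * Jc -
        Jc * heisenbergEvolution (localHamiltonian Φ univ) u (localHamiltonian Φ univ - localHamiltonian Φ B)‖ ≤
        Fintype.card Λ * J * η₁ := by
    intro u hu
    rw [localHamiltonian_univ_sub, heisenbergEvolution_finset_sum, finset_sum_commutator]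
    refine (norm_sum_le _ _).trans ?_
    calc ∑ Z ∈ univ.filter (fun Z : Finset Λ => ¬ Z ⊆ B),
          ‖heisenbergEvolution (localHamiltonian Φ univ) u (Φ Z) * Jc - Jc * heisenbergEvolution (localHamiltonian Φ univ) u (Φ Z)‖
        ≤ ∑ Z ∈ univ.filter (fun Z : Finset Λ => ¬ Z ⊆ B), η₁ * ‖Φ Z‖ := Finset.sum_le_sum (hterm u hu)
      _ = η₁ * ∑ Z ∈ univ.filter (fun Z : Finset Λ => ¬ Z ⊆ B), ‖Φ Z‖ := by rw [Finset.mul_sum]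
      _ ≤ η₁ * ∑ Z, ‖Φ Z‖ := mul_le_mul_of_nonneg_left
          (Finset.sum_le_sum_of_subset_of_nonneg (Finset.filter_subset _ _) fun _ _ _ => norm_nonneg _) hη₁0
      _ ≤ η₁ * (Fintype.card Λ * J) := mul_le_mul_of_nonneg_left h.sum_norm_le hη₁0
      _ = Fintype.card Λ * J * η₁ := by ring
  have := norm_gqaGenerator_sub_gqaGenerator_le_of_commutator hH hHB ha Jc hT (by positivity) hη
  rw [hη₁] at this
  exact this

end Dressing

end SpinLSM

end Literature.MathematicalPhysics.QuantumLattice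

end
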